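import Summits.Ventures.QEC.Census.HB.HB90a.BZStructX
import Summits.Ventures.QEC.Census.HB.HB90a.BZBoundsX
import Summits.Ventures.QEC.Census.HB.HB90a.BZInfoSetsX1
import Summits.Ventures.QEC.Census.HB.HB90a.BZEnumX01
import Summits.Ventures.QEC.Census.HB.HB90a.BZEnumX02
import Summits.Ventures.QEC.Census.HB.HB90a.BZEnumX03
import Summits.Ventures.QEC.Census.CertCheckBZSound
import Summits.Ventures.QEC.Census.CertChunks
import HarnessLib

/-!
# `HB90a` — `bz` certificate, side X: ASSEMBLY `d_X = 9` (tier KERNEL (CERTIFIED); emitted by qec-search-7)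

`(cert.code _).dX = 9` for the CSS code of the certificate (`Fin 90`, check matrices `rowMatrix 90 cert.HX/HZ`) by
type-10's `DistCert.dX_code_of_bz` (`Census/CertCheckBZSound.lean`: structural check of the distance certificate +
`bzXStruct` + `bzXLen` + every block) with each block recombined from its KERNEL information-set facts
(`BZInfoSetsX*`), its enumeration verdicts (`BZEnumX*`) and its bound (`BZBoundsX`) by
`CertBZInfoSets.bzXBlock_of_parts`.
-/

namespace Summit.Ventures.QEC.Census.HB90a

/-- Block 0 of side X passes type-10's block check (from its parts). -/
theorem blkX_0 : HB90a.cert.bzXBlock HB90a.bzData 0 = true :=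
  cert.bzXBlock_of_parts bzData (b := 0) (blk := bzBlockX0) rfl rfl
    (forall_lt_append (forall_lt_append (forall_lt_zero) (forall_lt_single 0 sysX_0_0)) (forall_lt_single 1 sysX_0_1))
    (forall_lt_append (forall_lt_append (forall_lt_zero) (forall_lt_single 0 enumX_0_0)) (forall_lt_single 1 enumX_0_1))
    boundX_0

/-- Block 1 of side X passes type-10's block check (from its parts). -/
theorem blkX_1 : HB90a.cert.bzXBlock HB90a.bzData 1 = true :=
  cert.bzXBlock_of_parts bzData (b := 1) (blk := bzBlockX1) rfl rfl
    (forall_lt_append (forall_lt_append (forall_lt_zero) (forall_lt_single 0 sysX_1_0)) (forall_lt_single 1 sysX_1_1))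
    (forall_lt_append (forall_lt_append (forall_lt_zero) (forall_lt_single 0 enumX_1_0)) (forall_lt_single 1 enumX_1_1))
    boundX_1

/-- Block 2 of side X passes type-10's block check (from its parts). -/
theorem blkX_2 : HB90a.cert.bzXBlock HB90a.bzData 2 = true :=
  cert.bzXBlock_of_parts bzData (b := 2) (blk := bzBlockX2) rfl rfl
    (forall_lt_append (forall_lt_append (forall_lt_zero) (forall_lt_single 0 sysX_2_0)) (forall_lt_single 1 sysX_2_1))
    (forall_lt_append (forall_lt_append (forall_lt_zero) (forall_lt_single 0 enumX_2_0)) (forall_lt_single 1 enumX_2_1))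
    boundX_2

set_option maxRecDepth 100000 in
/-- **`d_X = 9` for `HB90a`** (tier KERNEL (CERTIFIED)): the CSS code of the certificate has X-distance exactly 9. -/
theorem dX_eq_bz : (HB90a.cert.code (HB90a.cert.commOK_of_checkStructure (by decide +kernel))).dX = 9 :=
  HB90a.cert.dX_code_of_bz HB90a.bzData (by decide +kernel) bzXStruct_ok bzXLen_ok
    (forall_lt_append (forall_lt_append (forall_lt_append (forall_lt_zero) (forall_lt_single 0 blkX_0)) (forall_lt_single 1 blkX_1)) (forall_lt_single 2 blkX_2))

end Summit.Ventures.QEC.Census.HB90a
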